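import Summits.BirchSwinnertonDyer.BirchSwinnertonDyer.Theorems.GenusKolyvaginAtTwoSupplyKernelsLossless
import HarnessLib

/-!
# Route `GenusKolyvaginAtTwo` — support item `ShaVanishingAtDepthZeroAtTwo` (stmt-BirchSwinnertonDyer-31538, rev 54) BY NAME

Seat `bsd-line-gk2-p1` g23 (LEAD lineage, cell `bsd-f1-sign2`), `--workitem stmt-BirchSwinnertonDyer-31538`.
THEOREMS ONLY; no `sorry`.  **BSD is NOT proved by this**; no crux of the route is closed by it.

The item is gk2-p5 g34's UNCONDITIONAL §1 theorem
`GenusSupplyNarrow.Lossless.natCard_primaryComponent_sha_baseChange_two_eq_one_of_natCard_selmerGroup_eq_one` (p763xxx,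
`Theorems/GenusKolyvaginAtTwoSupplyKernelsLossless.lean`) typed VERBATIM as a route `Prop` (binders identical, same order): on the
`#Sel₂(E) = 1` habitat cell, an `(H2)`-frame with `y_K` of infinite order and `2^(M+1) ∤ P(1)`, and a twin `Wd ≅ E^(d_K)` with `#Sel₂(Wd) = 2`
inside the sign's Tamagawa budget, `Ш(E/K)[2^∞] = 0`.  Consumed by the deciding theorem `closes` (rev 54, LINE 25 engine).
References: [Kramer1981] Thm. 1; [GrossLMS1991] §5 Prop. 5.3; [McCallumLMS1991] §5 Lemma 5.1, Cor. 5.6.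
-/

set_option autoImplicit false
-- the Theorems namespace of this sub repeats the summit name by design (D-0017 nested layout)
set_option linter.dupNamespace false

namespace Summit.BirchSwinnertonDyer.BirchSwinnertonDyer.Theorems

open Summit.BirchSwinnertonDyer.BirchSwinnertonDyer.Theses.GenusKolyvaginAtTwo

/-- **`ShaVanishingAtDepthZeroAtTwo` (stmt-BirchSwinnertonDyer-31538) BY NAME**: on the `#Sel₂(E) = 1` cell of both supply cruxes, at an
`(H2)`-frame with `y_K` of infinite order, `2^(M+1) ∤ P(1)`, and a `#Sel₂ = 2` twin inside the sign's Tamagawa budget, `#Ш(E/K)[2^∞] = 1` —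
`exact GenusSupplyNarrow.Lossless.natCard_primaryComponent_sha_baseChange_two_eq_one_of_natCard_selmerGroup_eq_one` (unconditional, gk2-p5 g34).
BSD is NOT proved by this. [cite: Kramer1981, Thm. 1] [cite: GrossLMS1991, §5 Prop. 5.3] -/
theorem shaVanishingAtDepthZeroAtTwo_proof : ShaVanishingAtDepthZeroAtTwo := by
  unfold ShaVanishingAtDepthZeroAtTwo
  intro W _ _ _ K _ _ hT hr0 h1 hIQ hodd hHe hs2 Dt β ι d₁ hy M hndiv Wd _ hWd hSel hbudget
  exact GenusSupplyNarrow.Lossless.natCard_primaryComponent_sha_baseChange_two_eq_one_of_natCard_selmerGroup_eq_one W K hT hr0 h1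
    hIQ hodd hHe hs2 Dt β ι d₁ hy M hndiv Wd hWd hSel hbudget

end Summit.BirchSwinnertonDyer.BirchSwinnertonDyer.Theorems
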